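import Summits.RiemannHypothesis.RiemannHypothesis.Theorems.HandoffProlateDomination
import Summits.RiemannHypothesis.RiemannHypothesis.Theorems.HandoffMoebiusPreimage
import HarnessLib

/-!
# The peeling lemma for (PL): every fibre is inhabited by the explicit Möbius preimage (handoff idea-1 gen22 §119; landed by prove-1 gen14)

TEXT OF RECORD: idea-1 g22's `HandoffProlateDominationV2.lean`, §«The peeling lemma is a theorem»,
landed verbatim except that the inlined copy of `HandoffMoebiusPreimage` is replaced by the import and
`FibreNonempty`/`fibreNonempty` is stated directly as `fibre_nonempty`. For a Weil test `g` supported in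
`[-log λ, log λ]` put `φ(x) = x^{-1/2} g(log x)` (`x > 0`), `φ(x) = 0` (`x ≤ 0`) and
`f(y) = Σ_{1 ≤ m ≤ ⌈λ²⌉} μ(m) (φ(my) + φ(-my))`. Then `f` is smooth, even, supported in `[-λ, λ]`, and
its window part is `g`: the double sum collapses by `moebius_preimage_identity` with `N = ⌈λ²⌉`.
Consequences: `fibre_nonempty`, `prolateLeakage_le_leakage_moebiusPreimage`. Nothing here bears on the
truth of RH.
-/

set_option linter.dupNamespace false

noncomputable section

open scoped Real FourierTransform ContDiff Topology
open Complex MeasureTheory Set Filter Literature.NumberTheory.LFunctions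

namespace Summit.RiemannHypothesis.RiemannHypothesis.Theorems

namespace Prolate

/-! ## The peeling lemma is a theorem: `FibreNonempty` via the explicit Möbius preimage
(gen 22, addendum 2; IDEAS-prolate §112.4).  For a Weil test `g` supported in `[-log λ, log λ]`
put `φ(x) = x^{-1/2} g(log x)` (`x > 0`), `φ(x) = 0` (`x ≤ 0`) and
`f(y) = Σ_{1 ≤ m ≤ ⌈λ²⌉} μ(m) (φ(my) + φ(-my))`.  Then `f` is smooth (no extension lemma is needed:
`φ ≡ 0` on `(-∞, λ⁻¹)`), even, supported in `[-λ, λ]`, and its window part is `g`: the double sum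
collapses by handoff-prove-1's tree theorem `moebius_preimage_identity` (`HandoffMoebiusPreimage`,
inlined below as `moebius_preimage_identity`),
applied with `N = ⌈λ²⌉ ≥ λ/u` for `u = e^t ≥ λ⁻¹`; the term `n = ⌈λ²⌉` missing from `windowMap`
(which sums `n ≤ ⌊λ²⌋`) vanishes because `⌈λ²⌉ u > λ` when `λ² ∉ ℕ`. -/

/-- `φ_g(x) = x^{-1/2} g(log x)` for `x > 0` and `0` for `x ≤ 0`. -/
def mulPull (g : ℝ → ℂ) (x : ℝ) : ℂ :=
  if 0 < x then (((x ^ (-(1 / 2 : ℝ))) : ℝ) : ℂ) * g (Real.log x) else 0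

/-- The explicit Möbius preimage `f(y) = Σ_{m ≤ ⌈λ²⌉} μ(m) (φ_g(my) + φ_g(-my))`. -/
def moebiusPreimage (lam : ℝ) (g : ℝ → ℂ) (y : ℝ) : ℂ :=
  ∑ m ∈ Finset.Icc 1 ⌈lam ^ 2⌉₊,
    (ArithmeticFunction.moebius m : ℂ) * (mulPull g (m * y) + mulPull g (-(m * y)))

section Peeling

variable {lam : ℝ} {g : ℝ → ℂ}

/-- `φ_g(x) = 0` for `x ≤ 0`. -/
theorem mulPull_of_nonpos {x : ℝ} (hx : x ≤ 0) : mulPull g x = 0 := by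
  rw [mulPull, if_neg (not_lt.2 hx)]

/-- `φ_g(x) = x^{-1/2} g(log x)` for `x > 0`. -/
theorem mulPull_of_pos {x : ℝ} (hx : 0 < x) :
    mulPull g x = (((x ^ (-(1 / 2 : ℝ))) : ℝ) : ℂ) * g (Real.log x) := by
  rw [mulPull, if_pos hx]

/-- `g(t) = 0` for `t > log λ`. -/
theorem apply_eq_zero_of_log_lt (hsupp : tsupport g ⊆ Set.Icc (-Real.log lam) (Real.log lam))
    {t : ℝ} (ht : Real.log lam < t) : g t = 0 :=
  image_eq_zero_of_notMem_tsupport fun h => (not_le.2 ht) (hsupp h).2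

/-- `g(t) = 0` for `t < -log λ`. -/
theorem apply_eq_zero_of_lt_neg_log (hsupp : tsupport g ⊆ Set.Icc (-Real.log lam) (Real.log lam))
    {t : ℝ} (ht : t < -Real.log lam) : g t = 0 :=
  image_eq_zero_of_notMem_tsupport fun h => (not_le.2 ht) (hsupp h).1

/-- `φ_g(x) = 0` for `x > λ`. -/
theorem mulPull_eq_zero_of_gt (hlam : 1 ≤ lam)
    (hsupp : tsupport g ⊆ Set.Icc (-Real.log lam) (Real.log lam)) {x : ℝ} (hx : lam < x) :
    mulPull g x = 0 := by
  have hlam0 : 0 < lam := lt_of_lt_of_le one_pos hlam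
  rw [mulPull_of_pos (hlam0.trans hx), apply_eq_zero_of_log_lt hsupp (Real.log_lt_log hlam0 hx),
    mul_zero]

/-- `φ_g(x) = 0` for `x < λ⁻¹` — in particular near `0` and on the negative axis. -/
theorem mulPull_eq_zero_of_lt_inv (_hlam : 1 ≤ lam)
    (hsupp : tsupport g ⊆ Set.Icc (-Real.log lam) (Real.log lam)) {x : ℝ} (hx : x < lam⁻¹) :
    mulPull g x = 0 := by
  rcases le_or_gt x 0 with hx0 | hx0
  · exact mulPull_of_nonpos hx0
  · have h : Real.log x < -Real.log lam := by
      have := Real.log_lt_log hx0 hx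
      rwa [Real.log_inv] at this
    rw [mulPull_of_pos hx0, apply_eq_zero_of_lt_neg_log hsupp h, mul_zero]

/-- `φ_g` is smooth on `ℝ`. -/
theorem contDiff_mulPull (hlam : 1 ≤ lam) (hg : IsWeilTest g)
    (hsupp : tsupport g ⊆ Set.Icc (-Real.log lam) (Real.log lam)) : ContDiff ℝ ∞ (mulPull g) := by
  have hlam0 : 0 < lam := lt_of_lt_of_le one_pos hlam
  refine contDiff_iff_contDiffAt.2 fun x₀ => ?_
  rcases lt_or_ge x₀ lam⁻¹ with hx | hx
  · have h0 : mulPull g =ᶠ[𝓝 x₀] fun _ => (0 : ℂ) := by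
      filter_upwards [Iio_mem_nhds hx] with x hx' using mulPull_eq_zero_of_lt_inv hlam hsupp hx'
    exact contDiffAt_const.congr_of_eventuallyEq h0
  · have hx0 : 0 < x₀ := lt_of_lt_of_le (inv_pos.2 hlam0) hx
    have hform : mulPull g =ᶠ[𝓝 x₀]
        fun x => (((x ^ (-(1 / 2 : ℝ))) : ℝ) : ℂ) * g (Real.log x) := by
      filter_upwards [Ioi_mem_nhds hx0] with x hx' using mulPull_of_pos hx'
    have h1' : ContDiffAt ℝ ∞ (fun x : ℝ => Complex.ofRealCLM (x ^ (-(1 / 2 : ℝ)))) x₀ :=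
      Complex.ofRealCLM.contDiff.contDiffAt.comp x₀
        (Real.contDiffAt_rpow_const_of_ne (p := -(1 / 2 : ℝ)) hx0.ne')
    have h1 : ContDiffAt ℝ ∞ (fun x : ℝ => (((x ^ (-(1 / 2 : ℝ))) : ℝ) : ℂ)) x₀ := by
      simpa using h1'
    have h2 : ContDiffAt ℝ ∞ (fun x : ℝ => g (Real.log x)) x₀ :=
      hg.1.contDiffAt.comp x₀ (Real.contDiffAt_log.2 hx0.ne')
    exact (h1.mul h2).congr_of_eventuallyEq hform

/-- The Möbius preimage is smooth. -/
theorem contDiff_moebiusPreimage (hlam : 1 ≤ lam) (hg : IsWeilTest g)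
    (hsupp : tsupport g ⊆ Set.Icc (-Real.log lam) (Real.log lam)) :
    ContDiff ℝ ∞ (moebiusPreimage lam g) := by
  have hφ := contDiff_mulPull hlam hg hsupp
  have hterm : ∀ m : ℕ,
      ContDiff ℝ ∞ (fun y : ℝ => mulPull g (m * y) + mulPull g (-(m * y))) := by
    intro m
    have ha : ContDiff ℝ ∞ (fun y : ℝ => (m : ℝ) * y) := contDiff_const.mul contDiff_id
    exact (hφ.comp ha).add (hφ.comp ha.neg)
  rw [show moebiusPreimage lam g = fun y => ∑ m ∈ Finset.Icc 1 ⌈lam ^ 2⌉₊,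
      (ArithmeticFunction.moebius m : ℂ) * (mulPull g (m * y) + mulPull g (-(m * y))) from rfl]
  exact ContDiff.sum fun m _ => contDiff_const.mul (hterm m)

/-- The Möbius preimage is even. -/
theorem moebiusPreimage_neg (y : ℝ) :
    moebiusPreimage lam g (-y) = moebiusPreimage lam g y := by
  unfold moebiusPreimage
  refine Finset.sum_congr rfl fun m _ => ?_
  rw [mul_neg, neg_neg, add_comm]

/-- Auxiliary step of the peeling lemma. -/
theorem moebiusPreimage_eq_zero_of_gt (hlam : 1 ≤ lam)
    (hsupp : tsupport g ⊆ Set.Icc (-Real.log lam) (Real.log lam)) {y : ℝ} (hy : lam < y) :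
    moebiusPreimage lam g y = 0 := by
  have hlam0 : 0 < lam := lt_of_lt_of_le one_pos hlam
  have hy0 : 0 < y := hlam0.trans hy
  unfold moebiusPreimage
  refine Finset.sum_eq_zero fun m hm => ?_
  have hm1 : (1 : ℝ) ≤ m := by exact_mod_cast (Finset.mem_Icc.1 hm).1
  have hmy : lam < m * y := lt_of_lt_of_le hy (le_mul_of_one_le_left hy0.le hm1)
  have hneg : -((m : ℝ) * y) ≤ 0 := by linarith
  rw [mulPull_eq_zero_of_gt hlam hsupp hmy, mulPull_of_nonpos hneg, add_zero, mul_zero]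

/-- Auxiliary step of the peeling lemma. -/
theorem moebiusPreimage_eq_zero_of_lt (hlam : 1 ≤ lam)
    (hsupp : tsupport g ⊆ Set.Icc (-Real.log lam) (Real.log lam)) {y : ℝ} (hy : y < -lam) :
    moebiusPreimage lam g y = 0 := by
  rw [← moebiusPreimage_neg]
  exact moebiusPreimage_eq_zero_of_gt hlam hsupp (by linarith)

/-- Auxiliary step of the peeling lemma. -/
theorem tsupport_moebiusPreimage (hlam : 1 ≤ lam)
    (hsupp : tsupport g ⊆ Set.Icc (-Real.log lam) (Real.log lam)) :
    tsupport (moebiusPreimage lam g) ⊆ Set.Icc (-lam) lam := by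
  unfold tsupport
  refine closure_minimal (fun y hy => ?_) isClosed_Icc
  rw [Function.mem_support] at hy
  by_contra h
  rw [Set.mem_Icc, not_and_or, not_le, not_le] at h
  rcases h with h | h
  · exact hy (moebiusPreimage_eq_zero_of_lt hlam hsupp h)
  · exact hy (moebiusPreimage_eq_zero_of_gt hlam hsupp h)

/-- The dilation sum of the Möbius preimage collapses: `Σ_{n ≤ λ²} f(nu) = u^{-1/2} g(log u)` for
`u ≥ λ⁻¹` (tree theorem `moebius_preimage_identity` with `N = ⌈λ²⌉`). -/
theorem sum_moebiusPreimage (hlam : 1 ≤ lam)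
    (hsupp : tsupport g ⊆ Set.Icc (-Real.log lam) (Real.log lam)) {u : ℝ} (hul : lam⁻¹ ≤ u) :
    ∑ n ∈ Finset.Icc 1 ⌊lam ^ 2⌋₊, moebiusPreimage lam g (n * u) =
      (((u ^ (-(1 / 2 : ℝ))) : ℝ) : ℂ) * g (Real.log u) := by
  have hlam0 : 0 < lam := lt_of_lt_of_le one_pos hlam
  have hu : 0 < u := lt_of_lt_of_le (inv_pos.2 hlam0) hul
  have hlamu : lam ≤ lam ^ 2 * u := by
    calc lam = lam ^ 2 * lam⁻¹ := by
          rw [pow_two, mul_assoc, mul_inv_cancel₀ hlam0.ne', mul_one]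
      _ ≤ lam ^ 2 * u := by gcongr
  have hN1 : 1 ≤ ⌈lam ^ 2⌉₊ :=
    Nat.one_le_iff_ne_zero.mpr (Nat.ceil_pos.2 (by positivity : (0 : ℝ) < lam ^ 2)).ne'
  have hNu : lam / u ≤ (⌈lam ^ 2⌉₊ : ℕ) := by
    rw [div_le_iff₀ hu]
    exact hlamu.trans (by gcongr; exact Nat.le_ceil _)
  have hg' : ∀ x : ℝ, lam < x → g (Real.log x) = 0 := fun x hx =>
    apply_eq_zero_of_log_lt hsupp (Real.log_lt_log hlam0 hx)
  have hthm := moebius_preimage_identity (fun x => g (Real.log x)) hu hN1 hNu hg'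
  -- (A) the `windowMap` range `n ≤ ⌊λ²⌋` may be enlarged to `n ≤ ⌈λ²⌉`
  have hA : ∑ n ∈ Finset.Icc 1 ⌊lam ^ 2⌋₊, moebiusPreimage lam g (n * u) =
      ∑ n ∈ Finset.Icc 1 ⌈lam ^ 2⌉₊, moebiusPreimage lam g (n * u) := by
    apply Finset.sum_subset (Finset.Icc_subset_Icc_right (Nat.floor_le_ceil _))
    intro n hn hn'
    apply moebiusPreimage_eq_zero_of_gt hlam hsupp
    have hnf : ⌊lam ^ 2⌋₊ < n := by
      rw [Finset.mem_Icc] at hn hn'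
      omega
    have hn2 : lam ^ 2 < n := Nat.lt_of_floor_lt hnf
    calc lam ≤ lam ^ 2 * u := hlamu
      _ < n * u := by gcongr
  -- (B) on the positive axis only the `φ(my)` halves survive
  have hB : ∀ n ∈ Finset.Icc 1 ⌈lam ^ 2⌉₊, moebiusPreimage lam g (n * u) =
      ∑ m ∈ Finset.Icc 1 ⌈lam ^ 2⌉₊,
        (ArithmeticFunction.moebius m : ℂ) * mulPull g (m * (n * u)) := by
    intro n hn
    unfold moebiusPreimage
    refine Finset.sum_congr rfl fun m hm => ?_
    have hn0 : (0 : ℝ) < n := Nat.cast_pos.2 (Finset.mem_Icc.1 hn).1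
    have hm0 : (0 : ℝ) < m := Nat.cast_pos.2 (Finset.mem_Icc.1 hm).1
    have hpos : 0 < (m : ℝ) * (n * u) := by positivity
    rw [mulPull_of_nonpos (neg_nonpos.2 hpos.le), add_zero]
  -- (C) each term factors through `u^{-1/2}`
  have hC : ∀ n ∈ Finset.Icc 1 ⌈lam ^ 2⌉₊, ∀ m ∈ Finset.Icc 1 ⌈lam ^ 2⌉₊,
      (ArithmeticFunction.moebius m : ℂ) * mulPull g (m * (n * u)) =
        (((u ^ (-(1 / 2 : ℝ))) : ℝ) : ℂ) * ((ArithmeticFunction.moebius m : ℂ) *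
          Complex.ofReal (((n * m : ℕ) : ℝ) ^ (-(1 / 2 : ℝ))) *
            g (Real.log (((n * m : ℕ) : ℝ) * u))) := by
    intro n hn m hm
    have hn0 : (0 : ℝ) < n := Nat.cast_pos.2 (Finset.mem_Icc.1 hn).1
    have hm0 : (0 : ℝ) < m := Nat.cast_pos.2 (Finset.mem_Icc.1 hm).1
    have hpos : 0 < (m : ℝ) * (n * u) := by positivity
    have hnm : (m : ℝ) * (n * u) = ((n * m : ℕ) : ℝ) * u := by push_cast; ring
    rw [mulPull_of_pos hpos, hnm, Real.mul_rpow (by positivity) hu.le]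
    push_cast
    ring
  have hD : ∑ n ∈ Finset.Icc 1 ⌈lam ^ 2⌉₊, ∑ m ∈ Finset.Icc 1 ⌈lam ^ 2⌉₊,
      (ArithmeticFunction.moebius m : ℂ) * mulPull g (m * (n * u)) =
      (((u ^ (-(1 / 2 : ℝ))) : ℝ) : ℂ) * ∑ n ∈ Finset.Icc 1 ⌈lam ^ 2⌉₊, ∑ m ∈ Finset.Icc 1 ⌈lam ^ 2⌉₊,
        (ArithmeticFunction.moebius m : ℂ) * Complex.ofReal (((n * m : ℕ) : ℝ) ^ (-(1 / 2 : ℝ))) *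
          g (Real.log (((n * m : ℕ) : ℝ) * u)) := by
    rw [Finset.mul_sum]
    refine Finset.sum_congr rfl fun n hn => ?_
    rw [Finset.mul_sum]
    exact Finset.sum_congr rfl fun m hm => hC n hn m hm
  rw [hA, Finset.sum_congr rfl hB, hD, hthm]

/-- The window part of the Möbius preimage is `g` on `[-log λ, log λ]`. -/
theorem windowMap_moebiusPreimage (hlam : 1 ≤ lam)
    (hsupp : tsupport g ⊆ Set.Icc (-Real.log lam) (Real.log lam)) {t : ℝ}
    (ht : t ∈ Set.Icc (-Real.log lam) (Real.log lam)) :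
    windowMap lam (moebiusPreimage lam g) t = g t := by
  have hlam0 : 0 < lam := lt_of_lt_of_le one_pos hlam
  have hul : lam⁻¹ ≤ Real.exp t := by
    have := Real.exp_le_exp.2 ht.1
    rwa [Real.exp_neg, Real.exp_log hlam0] at this
  have hexp : Real.exp (t / 2) * Real.exp t ^ (-(1 / 2 : ℝ)) = 1 := by
    rw [Real.rpow_def_of_pos (Real.exp_pos t), Real.log_exp, ← Real.exp_add]
    convert Real.exp_zero using 2
    ring
  unfold windowMap
  rw [sum_moebiusPreimage hlam hsupp hul, Real.log_exp]
  calc (Real.exp (t / 2) : ℂ) * ((((Real.exp t ^ (-(1 / 2 : ℝ))) : ℝ) : ℂ) * g t)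
      = (((Real.exp (t / 2) * Real.exp t ^ (-(1 / 2 : ℝ))) : ℝ) : ℂ) * g t := by
        push_cast; ring
    _ = g t := by rw [hexp]; push_cast; ring

/-- The Möbius preimage lies in the fibre. -/
theorem moebiusPreimage_mem_fibre (hlam : 1 ≤ lam) (hg : IsWeilTest g)
    (hsupp : tsupport g ⊆ Set.Icc (-Real.log lam) (Real.log lam)) :
    moebiusPreimage lam g ∈ fibre lam g :=
  ⟨contDiff_moebiusPreimage hlam hg hsupp, moebiusPreimage_neg,
    tsupport_moebiusPreimage hlam hsupp,
    fun _ ht => (windowMap_moebiusPreimage hlam hsupp ht).symm⟩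

/-- ★ The PEELING LEMMA (IDEAS-prolate §99.3, §119): every fibre over a Weil test supported in the
window is non-empty. (So (PL) is never vacuous through empty fibres, and `prolateLeakage` is a
genuine infimum.) -/
theorem fibre_nonempty {lam : ℝ} (hlam : 1 ≤ lam) {g : ℝ → ℂ} (hg : IsWeilTest g)
    (hsupp : tsupport g ⊆ Set.Icc (-Real.log lam) (Real.log lam)) : (fibre lam g).Nonempty :=
  ⟨_, moebiusPreimage_mem_fibre hlam hg hsupp⟩

/-- Consequently the prolate leakage is bounded by the leakage of the explicit preimage. -/
theorem prolateLeakage_le_leakage_moebiusPreimage (hlam : 1 ≤ lam) (hg : IsWeilTest g)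
    (hsupp : tsupport g ⊆ Set.Icc (-Real.log lam) (Real.log lam)) :
    prolateLeakage lam g ≤ LatticeUncertainty.leakage lam (moebiusPreimage lam g) :=
  csInf_le ⟨0, fun _ ⟨f, _, hf⟩ => hf ▸ leakage_nonneg lam f⟩
    ⟨_, moebiusPreimage_mem_fibre hlam hg hsupp, rfl⟩

/-! Axiom census for the peeling lemma (expected: `propext`, `Classical.choice`, `Quot.sound`). -/
#print axioms fibre_nonempty

end Peeling

end Prolate

end Summit.RiemannHypothesis.RiemannHypothesis.Theorems
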